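import Literature.AnabelianGeometry.EtaleTheta.RealifiedDivisorMonoidsOfRlfWeak
import Literature.AnabelianGeometry.EtaleTheta.RealifiedDivisorMonoidsOfRlfQ

/-!
# [EtTh] Definition 3.6 (i): the realified data CONSTRUCTED for the monoid type `Λ = ℚ` over the WEAK
# vocabulary (`B₀^ℚ := B₀^pf`, `F₀^ℚ := F₀^pf`) — `RealifiedDivisorMonoids.ofRlfQWeak`

Mochizuki, *The étale theta function …*, Publ. RIMS **45** (2009), Def. 3.6 (i), PDF p.76 (printed
p.302) [cite: MochizukiEtTh2009, Def 3.6 p.76]: the display "`Φ₀^ℤ := Φ₀`; `Φ₀^ℚ := Φ₀^pf`;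
`Φ₀^ℝ := Φ₀^rlf`; `B₀^ℤ := B₀`; `B₀^ℚ := B₀^pf`; `B₀^ℝ := ℝ·Φ₀^birat ⊆ (Φ₀^ℝ)^gp`; `F₀^ℤ := F₀`;
`F₀^ℚ := F₀^pf`; `F₀^ℝ := ℝ·Φ₀^cnst ⊆ (Φ₀^ℝ)^gp` — where `Φ₀^rlf` is as in [Mzk17], Definition 2.4, (i)
[cf. Proposition 3.4, (i)]", together with the homomorphism `B₀^Λ → (Φ₀^ℝ)^gp` implicit in the fibre
products of Def. 3.6 (ii) (PDF p.77).  The perfection `M^pf` and its functoriality are [FrdI] §0 (kurims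
p.11) [cite: MochizukiFrdI2008, §0 p.11].

WEAK-VOCABULARY TWIN of `RealifiedDivisorMonoidsOfRlfQ.lean` (`ofRlfQ`, p414589, same seat), completing
— after `ofRlfZWeak` / `ofRlfRWeak` (`RealifiedDivisorMonoidsOfRlfWeak.lean`) — the Def. 3.6 (i)
constructor over abc-iut-L2-t3's `treeMonoidVocabWeak` for the third monoid type, under the repaired
Prop. 3.4 (i) `IsPerfFactorialCof` (cell findings F-L2d2-1 / F-L2d2-2; the printed hypothesis fails at
`Ÿ`, `Z_∞`): `B₀^ℚ := B₀^pf` (`perfectionFunctor B₀`), `F₀^ℚ := F₀^pf` (the image of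
`F₀(Y)^pf → B₀(Y)^pf`), and `B₀^ℚ → (Φ₀^ℝ)^gp` the unique extension of the `Λ = ℤ` map
`B₀ → Φ₀^gp → (Φ₀^ℝ)^gp` to the perfection (`Perfection.extend`; it exists because `(Φ₀^rlf)^gp` is
PERFECT for ANY realification data, `RealificationDataLemmas.isPerfect_gp` — reused from the strong file).
Every field of the interface is proved.  `ℝ·Φ₀^cnst` and the (non-)cuspidal parts are those of `ofRlfZWeak`.
Seat abc-iut-L6-t12 (cell abc-iut; F-L2d2-1 / F-L2d2-2 repair chain, piece (G)).  HONEST FRAMING: a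
construction over an abstract Def. 3.3 (iii) datum; nothing here bears on [IUTchIII] Cor. 3.12.
-/

noncomputable section

namespace Literature.AnabelianGeometry.EtaleTheta

open CategoryTheory Opposite Literature.AlgebraicGeometry.Frobenioids

universe u v w

namespace RealifiedDivisorMonoids

variable {D₀ : Type u} [Category.{v} D₀] (dm : DivisorMonoids.{u, v, w} D₀)
  (hpf : ∀ Y : D₀ᵒᵖ, IsPerfFactorialCof (dm.Φ₀.obj Y))

/-- `(Φ₀^ℝ)^gp(Y) = (Φ₀(Y)^rlf)^gp` (weak `Φ₀(Y)`) is perfect. [cite: MochizukiEtTh2009, Def 3.6 p.76] -/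
theorem isPerfect_gp_rlfWeak (Y : D₀ᵒᵖ) :
    IsPerfect (Algebra.GrothendieckGroup ((rlfFunctorWeak dm.Φ₀ hpf).obj Y)) :=
  RealificationDataLemmas.isPerfect_gp (realDataWeak dm hpf) (unop Y)

/-- **`B₀^ℚ(Y) = B₀(Y)^pf → (Φ₀^ℝ)^gp(Y)`** (weak `Φ₀(Y)`): the extension to the perfection of
`B₀(Y) → Φ₀(Y)^gp → (Φ₀(Y)^rlf)^gp` (Def. 3.6 (i): "induced by `B₀ → Φ₀^gp`").
[cite: MochizukiEtTh2009, Def 3.6 p.76] -/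
def divQWeak (Y : D₀ᵒᵖ) :
    Perfection (dm.B₀.obj Y) →* Algebra.GrothendieckGroup ((rlfFunctorWeak dm.Φ₀ hpf).obj Y) :=
  Perfection.extend (isPerfect_gp_rlfWeak dm hpf Y) ((ofRlfZWeak dm hpf).divΛ Y)

/-- `divQWeak` restricts to the `Λ = ℤ` map `B₀ → (Φ₀^ℝ)^gp` on `B₀(Y)`. [cite: MochizukiEtTh2009, Def 3.6 p.76] -/
@[simp] theorem divQWeak_of (Y : D₀ᵒᵖ) (b : dm.B₀.obj Y) :
    divQWeak dm hpf Y (Perfection.of _ b) = (ofRlfZWeak dm hpf).divΛ Y b :=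
  Perfection.extend_of _ _ b

/-- **Definition 3.6 (i) for the monoid type `Λ = ℚ` over the WEAK vocabulary, CONSTRUCTED**: as
`ofRlfZWeak`, but with `B₀^ℚ := B₀^pf` (the perfection functor), `F₀^ℚ := F₀^pf ⊆ B₀^pf` (the image of
`F₀(Y)^pf`), and `B₀^ℚ → (Φ₀^ℝ)^gp` the extension of `B₀ → (Φ₀^ℝ)^gp` to the perfection (target
perfect); every axiom of the interface is proved (naturality by uniqueness of maps out of a perfection
into a perfect monoid; `F₀^pf ↦ ℝ·Φ₀^cnst` by root-closedness of the span). [cite: MochizukiEtTh2009, Def 3.6 p.76] -/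
def ofRlfQWeak : RealifiedDivisorMonoids (D₀ := D₀) treeMonoidVocabWeak.{w} where
  toDivisorMonoids := dm
  Λ := MonoidType.Q
  ΦR := rlfFunctorWeak dm.Φ₀ hpf
  toR Y := ((toRlfNatTransWeak dm.Φ₀ hpf).app Y).hom
  toR_natural f x := (rlfMapWeak_toRealification_of dm.Φ₀ hpf f x).symm
  isRealification Y := isRealificationViaWeak_toRealification (hpf Y).weak
  BΛ := perfectionFunctor dm.B₀
  isUnit_BΛ Y b := by
    obtain ⟨⟨a, n⟩, rfl⟩ := Perfection.mk_surjective b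
    change IsUnit (Perfection.mk a n)
    rw [← isUnit_pow_iff (PNat.ne_zero n), Perfection.mk_pow_self]
    exact (dm.isUnit_B₀ Y a).map (Perfection.of _)
  divΛ Y := divQWeak dm hpf Y
  divΛ_natural {Y Y'} f b := by
    -- both sides are homomorphisms `B₀(Y)^pf → (Φ₀^ℝ)^gp(Y')` into a perfect monoid agreeing on `B₀(Y)`
    have key : (divQWeak dm hpf Y').comp (Perfection.map (dm.B₀.map f).hom) =
        (gpMap ((rlfFunctorWeak dm.Φ₀ hpf).map f).hom).comp (divQWeak dm hpf Y) := by
      apply Perfection.hom_ext_of_isPerfect (isPerfect_gp_rlfWeak dm hpf Y')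
      ext a
      change divQWeak dm hpf Y' (Perfection.map (dm.B₀.map f).hom (Perfection.of _ a)) =
        gpMap ((rlfFunctorWeak dm.Φ₀ hpf).map f).hom (divQWeak dm hpf Y (Perfection.of _ a))
      rw [show Perfection.map (dm.B₀.map f).hom (Perfection.of _ a) =
          Perfection.of _ ((dm.B₀.map f).hom a) from rfl, divQWeak_of, divQWeak_of]
      exact (ofRlfZWeak dm hpf).divΛ_natural f a
    exact DFunLike.congr_fun key b
  FΛ Y := MonoidHom.mrange (Perfection.map (dm.F₀ Y).subtype)
  FΛ_map {Y Y'} f b hb := by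
    obtain ⟨x, rfl⟩ := hb
    -- `B₀(f)^pf ∘ (F₀(Y) ⊆ B₀(Y))^pf = (F₀(Y') ⊆ B₀(Y'))^pf ∘ (F₀(f))^pf`
    let r : dm.F₀ Y →* dm.F₀ Y' :=
      ((dm.B₀.map f).hom.comp (dm.F₀ Y).subtype).codRestrict (dm.F₀ Y') fun c => dm.F₀_map f c c.2
    refine ⟨Perfection.map r x, ?_⟩
    change Perfection.map (dm.F₀ Y').subtype (Perfection.map r x) =
      Perfection.map (dm.B₀.map f).hom (Perfection.map (dm.F₀ Y).subtype x)
    rw [← MonoidHom.comp_apply, ← Perfection.map_comp, ← MonoidHom.comp_apply, ← Perfection.map_comp]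
    rfl
  cnstR Y := ((realDataWeak dm hpf).realSpan dm.cnstGp).carrier (unop Y)
  cnstR_map {Y Y'} f x hx := by
    have h := ((realDataWeak dm hpf).realSpan dm.cnstGp).pull_mem f.unop hx
    rwa [pullGp, ← gpMap_eq_monGpMap] at h
  divΛ_mem_cnstR Y b hb := by
    obtain ⟨x, rfl⟩ := hb
    obtain ⟨⟨a, n⟩, rfl⟩ := Perfection.mk_surjective x
    -- `(divQ b)^n = divQ (of a) = ι(div₀ a) ∈ ℝ·Φ₀^cnst`, and the span is root-closed
    apply RealificationDataLemmas.mem_realSpan_of_pow_mem (realDataWeak dm hpf) dm.cnstGp (unop Y) n.pos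
    change divQWeak dm hpf Y (Perfection.map (dm.F₀ Y).subtype (Perfection.mk a n)) ^ (n : ℕ) ∈ _
    rw [← map_pow, ← map_pow, Perfection.mk_pow_self, show Perfection.map (dm.F₀ Y).subtype
      (Perfection.of _ a) = Perfection.of _ (a : dm.B₀.obj Y) from rfl, divQWeak_of]
    exact (ofRlfZWeak dm hpf).divΛ_mem_cnstR Y (a : dm.B₀.obj Y) a.2
  cnstR_root Y g n hg := RealificationDataLemmas.mem_realSpan_of_pow_mem _ _ (unop Y) n.pos hg
  cnst_le_cnstR Y b hb := (ofRlfZWeak dm hpf).cnst_le_cnstR Y b hb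
  ncspR Y := rlfSuppInWeak (hpf Y).weak (toRSuppOfWeak dm hpf Y (dm.ncsp₀ Y))
  cspR Y := rlfSuppInWeak (hpf Y).weak (toRSuppOfWeak dm hpf Y (dm.csp₀ Y))
  toR_ncsp Y x hx := supp_toR_subset_toRSuppOfWeak dm hpf Y hx
  toR_csp Y x hx := supp_toR_subset_toRSuppOfWeak dm hpf Y hx

/-- The monoid type of `ofRlfQWeak` is `ℚ`. [cite: MochizukiEtTh2009, Def 3.6 p.76] -/
@[simp] theorem ofRlfQWeak_Λ : (ofRlfQWeak dm hpf).Λ = MonoidType.Q := rfl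

/-- `Φ₀^ℝ` of `ofRlfQWeak` is the weak realification functor. [cite: MochizukiEtTh2009, Def 3.6 p.76] -/
@[simp] theorem ofRlfQWeak_ΦR : (ofRlfQWeak dm hpf).ΦR = rlfFunctorWeak dm.Φ₀ hpf := rfl

/-- `B₀^ℚ := B₀^pf`. [cite: MochizukiEtTh2009, Def 3.6 p.76] -/
@[simp] theorem ofRlfQWeak_BΛ : (ofRlfQWeak dm hpf).BΛ = perfectionFunctor dm.B₀ := rfl

/-- `F₀^ℚ := F₀^pf` (the image of `F₀(Y)^pf → B₀(Y)^pf`). [cite: MochizukiEtTh2009, Def 3.6 p.76] -/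
theorem ofRlfQWeak_FΛ (Y : D₀ᵒᵖ) :
    (ofRlfQWeak dm hpf).FΛ Y = MonoidHom.mrange (Perfection.map (dm.F₀ Y).subtype) := rfl

/-- `B₀^ℚ → (Φ₀^ℝ)^gp` of `ofRlfQWeak` is `divQWeak`. [cite: MochizukiEtTh2009, Def 3.6 p.76] -/
theorem ofRlfQWeak_divΛ (Y : D₀ᵒᵖ) : (ofRlfQWeak dm hpf).divΛ Y = divQWeak dm hpf Y := rfl

/-- `ofRlfQWeak` shares `ℝ·Φ₀^cnst` with `ofRlfZWeak`. [cite: MochizukiEtTh2009, Def 3.6 p.76] -/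
theorem ofRlfQWeak_cnstR (Y : D₀ᵒᵖ) : (ofRlfQWeak dm hpf).cnstR Y = (ofRlfZWeak dm hpf).cnstR Y := rfl

/-- Same non-cuspidal parts as `ofRlfZWeak`. [cite: MochizukiEtTh2009, Def 3.6 p.77] -/
theorem ofRlfQWeak_ncspR (Y : D₀ᵒᵖ) : (ofRlfQWeak dm hpf).ncspR Y = (ofRlfZWeak dm hpf).ncspR Y := rfl

/-- Same cuspidal parts as `ofRlfZWeak`. [cite: MochizukiEtTh2009, Def 3.6 p.77] -/
theorem ofRlfQWeak_cspR (Y : D₀ᵒᵖ) : (ofRlfQWeak dm hpf).cspR Y = (ofRlfZWeak dm hpf).cspR Y := rfl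

/-- `ofRlfQWeak` keeps the Def. 3.3 (iii) data. [cite: MochizukiEtTh2009, Def 3.6 p.76] -/
theorem ofRlfQWeak_toDivisorMonoids : (ofRlfQWeak dm hpf).toDivisorMonoids = dm := rfl

end RealifiedDivisorMonoids

end Literature.AnabelianGeometry.EtaleTheta

end
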